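import Mathlib
import Literature.Computability.Complexity.SignDegreeXor
import HarnessLib.Audit
import Summits.PneNP.PneNP.Theorems.PstarPairwise
import Summits.PneNP.PneNP.Theorems.PairwiseSALevel
import Summits.PneNP.PneNP.Theorems.PstarIP3Law

/-!
# Uniformity levels of the `P⋆` and `IP₃` fibres (ROUND-23, T23.2; cell `pnp-ideate`)

FRONTIER range-avoidance ladder, rung F-N3 context (finite facts about two predicates — nothing here bears on `P` vs `NP`).

The print lower-bound machinery for LP/SDP hierarchies on CSPs (BGMT12, KMOW17) and the print refutation thresholds
(AOW15, RRS17) are calibrated by the largest `t` for which the relevant fibre `P⁻¹(b)` supports a `t`-wise UNIFORM law.  The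
cell's Sherali–Adams constructions (`PairwiseSALevel.PairwiseLaws`, ROUND-21/22/23) use instead pairwise independence with
`1/√2`-BIASED marginals, which both fibres of `P⋆(x,x′,a,a′) = x ⊕ x′ ⊕ (a ∧ a′)` and of `IP₃` carry (`PstarIP3Law.ip3PairwiseLaws`,
the ROUND-21 typed laws).  This file records, as exact finite facts, where the UNIFORM notion stands for the same predicates:

* `pstar_no_pairwiseUniform b` — NEITHER fibre of `P⋆` supports a pairwise-uniform law (Farkas certificate: the degree-`2`
  polynomial `(2s−1) − 4s([u₀]+[u₁]) + 8s[u₀][u₁] + 4[u₂][u₃]`, `s = ∓1`, is `≡ 1` on the fibre and has moment value `0`);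
* `ip3_true_no_pairwiseUniform` — the fibre `IP₃ = 1` supports none (certificate `[u₀u₁]+[u₂u₃]+[u₄u₅] ≥ 1` on the fibre, moment
  value `3/4`);
* `ip3_false_pairwiseUniform` — the fibre `IP₃ = 0` DOES: the explicit `12`-point law `lawIP3zero` (mass `1/8` on each "two AND-pairs
  `11`, the third `00`", `1/8` on `000000`, `1/16` on each pattern with every AND-pair in `{10, 01}`).

Reading (memo r23 §3): in the unbiased sense `P⋆` sits BELOW `t = 2`, so uniform-marginal frameworks give nothing for monotone `P⋆`
instances, while in the biased sense both predicates sit exactly at `t = 2` (pairwise yes, `3`-wise no) — the level whose heuristic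
refutation threshold `m ≈ n^{3/2}` is the print algorithmic threshold for `NC⁰₄`-AVOID.
-/

set_option linter.dupNamespace false

open Finset
open Literature.Computability.Complexity
open Summit.PneNP.PneNP.Theorems.PairwiseSALevel (marg1 marg2)
open Summit.PneNP.PneNP.Theorems.PstarPairwise (sum_fin4)
open Summit.PneNP.PneNP.Theorems.PstarIP3Law (sum_fin6 ipPred_three_cons)

namespace Summit.PneNP.PneNP.Theorems.FibreUniformityLevels

variable {k : ℕ}

/-- A **pairwise-uniform law on the fibre `P⁻¹(b)`**: a probability law on `{0,1}^k` supported on the fibre whose one-slot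
marginals are all `1/2` and whose two-slot marginals are all `1/4` (balanced pairwise independence). -/
def PairwiseUniformOn (P : (Fin k → Bool) → Bool) (b : Bool) (w : (Fin k → Bool) → ℝ) : Prop :=
  (∀ u, 0 ≤ w u) ∧ (∀ u, w u ≠ 0 → P u = b) ∧ ∑ u, w u = 1 ∧
    (∀ (i : Fin k) (α : Bool), marg1 w i α = 1 / 2) ∧
    (∀ i j : Fin k, i ≠ j → ∀ α β : Bool, marg2 w i j α β = 1 / 4)

/-- Indicator of `u i = 1`. -/
def ind1 (u : Fin k → Bool) (i : Fin k) : ℝ := if u i = true then 1 else 0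

/-- Indicator of `u i = u j = 1`. -/
def ind2 (u : Fin k → Bool) (i j : Fin k) : ℝ := if u i = true ∧ u j = true then 1 else 0

/-- First moments are one-slot marginals. -/
theorem sum_mul_ind1 (w : (Fin k → Bool) → ℝ) (i : Fin k) : ∑ u, w u * ind1 u i = marg1 w i true := by
  unfold ind1 PairwiseSALevel.marg1
  refine Finset.sum_congr rfl fun u _ => ?_
  split_ifs <;> simp

/-- Second moments are two-slot marginals. -/
theorem sum_mul_ind2 (w : (Fin k → Bool) → ℝ) (i j : Fin k) : ∑ u, w u * ind2 u i j = marg2 w i j true true := by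
  unfold ind2 PairwiseSALevel.marg2
  refine Finset.sum_congr rfl fun u _ => ?_
  split_ifs <;> simp

/-- A function on `{0,1}⁴` is determined by its four values. -/
theorem eq_vec4 (u : Fin 4 → Bool) : u = ![u 0, u 1, u 2, u 3] := by
  funext i; fin_cases i <;> rfl

/-- A function on `{0,1}⁶` is determined by its six values. -/
theorem eq_vec6 (u : Fin 6 → Bool) : u = ![u 0, u 1, u 2, u 3, u 4, u 5] := by
  funext i; fin_cases i <;> rfl

/-! ### `P⋆`: no pairwise-uniform law on either fibre -/

/-- The sign `s(b) = −1` for the fibre `P⋆ = 1`, `+1` for `P⋆ = 0`. -/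
def sgn (b : Bool) : ℝ := if b then -1 else 1

/-- The Farkas certificate for `P⋆⁻¹(b)`. -/
def certPstar (b : Bool) (u : Fin 4 → Bool) : ℝ :=
  (2 * sgn b - 1) - 4 * sgn b * ind1 u 0 - 4 * sgn b * ind1 u 1 + 8 * sgn b * ind2 u 0 1 + 4 * ind2 u 2 3

/-- The certificate is identically `1` on the fibre. -/
theorem certPstar_eq_one (b : Bool) (u : Fin 4 → Bool) (hu : xorAndPred u = b) : certPstar b u = 1 := by
  rw [eq_vec4 u] at hu ⊢
  revert hu
  cases b <;> cases u 0 <;> cases u 1 <;> cases u 2 <;> cases u 3 <;>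
    simp [xorAndPred_apply, certPstar, sgn, ind1, ind2] <;> norm_num

/-- Its moment value under any law with uniform slots `0,1` and uniform pairs `(0,1)`, `(2,3)` is `0`. -/
theorem sum_certPstar (b : Bool) (w : (Fin 4 → Bool) → ℝ) (htot : ∑ u, w u = 1) (h0 : marg1 w 0 true = 1 / 2)
    (h1 : marg1 w 1 true = 1 / 2) (h01 : marg2 w 0 1 true true = 1 / 4) (h23 : marg2 w 2 3 true true = 1 / 4) :
    ∑ u, w u * certPstar b u = 0 := by
  have e : ∀ u, w u * certPstar b u = (2 * sgn b - 1) * w u - 4 * sgn b * (w u * ind1 u 0) - 4 * sgn b * (w u * ind1 u 1) +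
      8 * sgn b * (w u * ind2 u 0 1) + 4 * (w u * ind2 u 2 3) := fun u => by unfold certPstar; ring
  simp only [e, Finset.sum_add_distrib, Finset.sum_sub_distrib, ← Finset.mul_sum, sum_mul_ind1, sum_mul_ind2, htot, h0, h1,
    h01, h23]
  cases b <;> simp [sgn] <;> norm_num

/-- **T23.2(a).**  Neither fibre of `P⋆` supports a pairwise-uniform law. -/
theorem pstar_no_pairwiseUniform (b : Bool) : ¬ ∃ w, PairwiseUniformOn xorAndPred b w := by
  rintro ⟨w, -, hsupp, htot, hm1, hm2⟩
  have hS : ∑ u, w u * certPstar b u = ∑ u, w u := Finset.sum_congr rfl fun u _ => by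
    by_cases h : w u = 0
    · simp [h]
    · rw [certPstar_eq_one b u (hsupp u h), mul_one]
  have h0 := sum_certPstar b w htot (hm1 0 true) (hm1 1 true) (hm2 0 1 (by decide) true true) (hm2 2 3 (by decide) true true)
  rw [hS, htot] at h0
  exact one_ne_zero h0

/-! ### `IP₃ = 1`: no pairwise-uniform law -/

/-- The number of AND-pairs equal to `11`. -/
def nOnes (u : Fin 6 → Bool) : ℝ := ind2 u 0 1 + ind2 u 2 3 + ind2 u 4 5

/-- On the fibre `IP₃ = 1` at least one AND-pair is `11`. -/
theorem one_le_nOnes (u : Fin 6 → Bool) (hu : ipPred 3 u = true) : 1 ≤ nOnes u := by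
  rw [eq_vec6 u] at hu ⊢
  revert hu
  rw [ipPred_three_cons]
  cases u 0 <;> cases u 1 <;> cases u 2 <;> cases u 3 <;> cases u 4 <;> cases u 5 <;> simp [nOnes, ind2]

/-- **T23.2(b).**  The fibre `IP₃ = 1` supports no pairwise-uniform law. -/
theorem ip3_true_no_pairwiseUniform : ¬ ∃ w, PairwiseUniformOn (ipPred 3) true w := by
  rintro ⟨w, hnn, hsupp, htot, -, hm2⟩
  have hS : ∑ u, w u * nOnes u = 3 / 4 := by
    simp only [nOnes, mul_add, Finset.sum_add_distrib, sum_mul_ind2, hm2 0 1 (by decide), hm2 2 3 (by decide),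
      hm2 4 5 (by decide)]
    norm_num
  have hle : ∑ u, w u ≤ ∑ u, w u * nOnes u := Finset.sum_le_sum fun u _ => by
    by_cases h : w u = 0
    · simp [h]
    · simpa using mul_le_mul_of_nonneg_left (one_le_nOnes u (hsupp u h)) (hnn u)
  rw [htot, hS] at hle
  norm_num at hle

/-! ### `IP₃ = 0`: an explicit pairwise-uniform law -/

/-- The `12`-point law on `IP₃⁻¹(0)` as a function of the six bits. -/
noncomputable def nu0 (a0 a1 a2 a3 a4 a5 : Bool) : ℝ :=
  if (a0 && a1 && a2 && a3 && !a4 && !a5) || (a0 && a1 && !a2 && !a3 && a4 && a5) ||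
      (!a0 && !a1 && a2 && a3 && a4 && a5) || (!a0 && !a1 && !a2 && !a3 && !a4 && !a5) then 1 / 8
  else if (xor a0 a1) && (xor a2 a3) && (xor a4 a5) then 1 / 16 else 0

/-- The law `lawIP3zero` on `{0,1}⁶`. -/
noncomputable def lawIP3zero (u : Fin 6 → Bool) : ℝ := nu0 (u 0) (u 1) (u 2) (u 3) (u 4) (u 5)

/-- The law on an explicit pattern. -/
theorem lawIP3zero_cons (a0 a1 a2 a3 a4 a5 : Bool) : lawIP3zero ![a0, a1, a2, a3, a4, a5] = nu0 a0 a1 a2 a3 a4 a5 := rfl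

/-- It is nonnegative. -/
theorem lawIP3zero_nonneg (u : Fin 6 → Bool) : 0 ≤ lawIP3zero u := by
  unfold lawIP3zero nu0; split_ifs <;> norm_num

/-- It is supported on the fibre `IP₃ = 0`. -/
theorem lawIP3zero_support (u : Fin 6 → Bool) (h : lawIP3zero u ≠ 0) : ipPred 3 u = false := by
  rw [eq_vec6 u] at h ⊢
  rw [ipPred_three_cons, lawIP3zero_cons] at *
  revert h
  cases u 0 <;> cases u 1 <;> cases u 2 <;> cases u 3 <;> cases u 4 <;> cases u 5 <;> simp [nu0]

/-- It has total mass `1`. -/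
theorem lawIP3zero_total : ∑ u, lawIP3zero u = 1 := by
  simp [sum_fin6, lawIP3zero_cons, nu0]; norm_num

/-- Its one-slot marginals are uniform. -/
theorem lawIP3zero_marg1 (i : Fin 6) (α : Bool) : marg1 lawIP3zero i α = 1 / 2 := by
  fin_cases i <;> cases α <;> (simp [PairwiseSALevel.marg1, sum_fin6, lawIP3zero_cons, nu0]; norm_num)

/-- Its two-slot marginals are uniform (pairs `i < j`). -/
theorem lawIP3zero_marg2_lt (i j : Fin 6) (hij : i < j) (α β : Bool) : marg2 lawIP3zero i j α β = 1 / 4 := by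
  fin_cases i <;> fin_cases j <;> simp at hij <;> cases α <;> cases β <;>
    (simp [PairwiseSALevel.marg2, sum_fin6, lawIP3zero_cons, nu0]; norm_num)

/-- Its two-slot marginals are uniform. -/
theorem lawIP3zero_marg2 (i j : Fin 6) (hij : i ≠ j) (α β : Bool) : marg2 lawIP3zero i j α β = 1 / 4 := by
  rcases lt_or_gt_of_ne hij with h | h
  · exact lawIP3zero_marg2_lt i j h α β
  · rw [PstarIP3Law.marg2_comm]; exact lawIP3zero_marg2_lt j i h β α

/-- **T23.2(c).**  The fibre `IP₃ = 0` supports a pairwise-uniform law. -/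
theorem ip3_false_pairwiseUniform : ∃ w, PairwiseUniformOn (ipPred 3) false w :=
  ⟨lawIP3zero, lawIP3zero_nonneg, lawIP3zero_support, lawIP3zero_total, lawIP3zero_marg1, lawIP3zero_marg2⟩

end Summit.PneNP.PneNP.Theorems.FibreUniformityLevels
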